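/-
Copyright: lit-balaban Phase-2 proof seat p08 (gen 7).  Statement-level skeleton of a published paper; no proof claims beyond what
the kernel checks below.
-/
import Literature.MathematicalPhysics.QuantumFieldTheory.BalabanImbrieJaffe1984to88.BIJ88Ineq217LandauTorus

/-!
# `BalabanImbrieJaffe1984to88.BIJ88Ineq217GradKernel` — T. Bałaban, J. Imbrie, A. Jaffe, *Effective action and cluster properties of
the abelian Higgs model*, Commun. Math. Phys. **114** (1988) 257–315 [BalabanImbrieJaffe1988]: **(2.17)** p. 262 on the torus with the
near-part input IN THE PRINTED KERNEL SHAPE of [I] (7.2.1)–(7.2.2) — the sup-operator hypothesis `hH` of gen 7's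
`BIJ88Ineq217LandauTorus.abs_ineq217_landau_torus` (*"σ_k is a bounded operator on curls [2]"* through the Landau minimizer) is DERIVED
from a kernel bound `|∂^{c}H_k(p; b)| ≤ Me^{−δ|x_k − y|}` (the gradient member of [I] (7.2.2): *"The kernel H_{k,μν}(x,y) and its gradient
decay exponentially"*) by the linearity (7.2.1) of `H_k` and the uniform exponential row sums of the tori ([B3] (2.15),
`B3TorusRadialSums.sum_exp_neg_tdist_le`), so that (2.17) holds for p30's `sigmaTorus` with a k-INDEPENDENT constant given only the two
KERNEL estimates print cites: (2.16) for σ_k and (7.2.2) for `∇H_k`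

statement-level skeleton of published theorems with citation tags; proofs where landed; nothing here is a claim about the Yang–Mills mass gap

PDF held: `paper:balaban1988-cmp114-bij-abelian-higgs-effective-action` (journal page = PDF page + 256), p. 262 [PDF 6]; [I] =
[BalabanImbrieJaffe1985] (`paper:balaban1985-cmp97-bij-higgs-minimizers`) p. 325 [PDF 27] (text layer re-read this session).

CITATION HEADER (lean-in-tree rule).  Part of the lit-balaban TYPED SKELETON (HOME `run/shared/lean/pub/lit-balaban/`), Phase-2 proof
seat p08 (gen 7), unit `lit-balaban-p08`; WHAT IS REPRODUCED = SKELETON row **C2.Eq2.17** (owner r18, referee ref-5), kind «model instance»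
for the torus σ_k, and the (7.2.1) linearity / (7.2.2)-gradient INPUT SHAPE of row **C1.Eq7.2.1-7.2.2** (owner r15) for p11's Landau
minimizer `HkE`; companion of `BIJ88Ineq217LandauTorus` (p257207).  TAKING line HOME/STATUS.md (gen 7, seventh target).

THE PRINTED TEXT ([I] p. 325 [PDF 27], verbatim): *"The minimizer H_k can be expressed as an integral kernel. For x ∈ T_η, (H_kB)_μ(x) =
Σ_{y∈T₁^{(k)},ν} H_{k,μν}(x; y)B_ν(y). (7.2.1) The kernel H_{k,μν}(x,y) and its gradient decay exponentially. In particular there exists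
δ > 0 and for 0 ≦ α < 1 a constant M = M(α) < ∞ such that for |x − x′| ≦ 1, |H_{k,μν}(x,y)| + |∇H_{k,μν}(x,y)| + … ≦ Me^{−δ|x−y|}.
(7.2.2)"*; C2 p. 262: *"The near part is similarly bounded since σ_k is a bounded operator on curls [2]."*

THE TORUS DATA (all in the tree): the Landau minimizer `H_k = HkE P w c k` (p11) on unit bond fields `toEj B` (`B : PBond P k → ℝ`), the
η-lattice curl `curl c`, the KERNEL of `B ↦ ∂^{c}H_kB`, `K(p; b) := (∂^{c}H_k e_b)(p)` (`e_b = δ_b`), the block point `x_k = blk k x`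
((I.5.1.2), p08 gen 2) and the `T^{(k)}` torus distance `tdist`; everything else as in `BIJ88Ineq217LandauTorus`.

WHAT IS PROVED (0 `sorry`, standard axioms; theorems only — proof lane):
* §1 **(7.2.1) for `∂^{c}H_k` on the tori**, `curlHk_apply_eq_sum`: `(∂^{c}H_kB)(p) = Σ_b K(p; b)B(b)` (linearity of `HkE`, `toEj`, `curl`).
* §2 **kernel bound ⟹ operator bound**, `abs_curlHk_le_of_kernel`: `|K(p; b)| ≤ Me^{−δ·dist(p,b)}` with row sums `≤ S` gives the
  hypothesis `hH` of `BIJ88Ineq217LandauTorus` with `M_H = M·S` (any distance function `dist`).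
* §3 the printed distance `|x_k − y|` on the tori: `sum_bond_exp_neg_blkdist_le` — `Σ_{b∈T^{(k)}} e^{−δ|x_k − b₋|} ≤ d(2(1+δ⁻¹))^d`
  uniformly in the volume and in `k` (`B3TorusRadialSums.sum_exp_neg_tdist_le` + `LatticeFieldCalculus.bondEquiv`); `hH_of_gradKernel`.
* §4 **`abs_ineq217_gradKernel_torus`** / **`_eta`** — (2.17) ON THE TORUS FOR THE σ_k OF RECORD given ONLY the two kernel estimates
  (2.16) (σ_k beyond `R` at `p₁`, row sum `S`) and the gradient member of (7.2.2) for `H_k` (`|∂^{c}H_k(p; b)| ≤ Me^{−δ|x_k(p) − b₋|}`): at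
  `w = η^d`, `c = η⁻¹` the constant is `M·d(2(1+δ⁻¹))^d·(d−1)·2R + c₀S(1 + 8(d−1)R)`, INDEPENDENT OF `k`.
HONEST SCOPE.  The displayed kernel bound is the gradient member of (7.2.2) read for p11's `HkE` with `|x − y|` = the `T^{(k)}` block
distance `|x_k − y|` (as in p09's `BIJ85Ineq724Torus.ineq724_torus_block`); deriving it from r15's typed `KernelData.Ineq722` for p09's
`torusRep` kernel needs the `HkE` ↔ (1.103) bridge, not done here; (2.16) stays displayed; constants explicit, not print's `1`; no `def`,
no new named fact; NOT summit progress.  Unit `lit-balaban-p08` (literature-prover-lit-balaban-p08-g7-0), 2026-08-21.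
-/

open scoped BigOperators RealInnerProductSpace

namespace Literature.MathematicalPhysics.QuantumFieldTheory.BalabanImbrieJaffe1984to88.BIJ88Ineq217GradKernel

open Balaban1983to89 hiding Site Plaq
open Balaban1983to89.LatticeFieldCalculus Balaban1983to89.T4AxialGaugeSmallField
open Balaban1983to89.B3TorusRadialSums (sum_exp_neg_tdist_le)
open BIJ88Sect2Statements BIJ88Close235Proof BIJ88Ineq217Mechanism BIJ88Ineq217NearPart BIJ88Ineq217Torus BIJ88Ineq217SigmaTorus
  BIJ88Ineq217LandauTorus
open BIJ85AxialPropagator411 BIJ85Prop521Torus BIJ85Sigma421Torus BIJ85Eq611Torus BIJ85Prop522Torus BIJ85Sigma422Eta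
open BIJ85GaugeFunction5113 (blk)
-- inside this namespace the bare `Site`/`Plaq` are the `ℤ^d` carriers of the QFT root; the torus ones are renamed:
open Balaban1983to89 renaming Site → TSite, Plaq → TPlaq

noncomputable section

variable {P : Params}

/-! ## §1  (7.2.1) for `∂^{c}H_k`: the kernel of `B ↦ ∂^{c}H_kB` -/

/-- a function on a finite type is the sum of its coordinates times the coordinate vectors. [folklore] -/
private theorem pi_eq_sum_single' {ι : Type*} [Fintype ι] [DecidableEq ι] (B : ι → ℝ) :
    B = ∑ b, B b • (Pi.single b (1 : ℝ) : ι → ℝ) := by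
  funext i
  rw [Finset.sum_apply, Finset.sum_eq_single i]
  · rw [Pi.smul_apply, Pi.single_eq_same, smul_eq_mul, mul_one]
  · intro b _ hb
    rw [Pi.smul_apply, Pi.single_eq_of_ne (Ne.symm hb), smul_zero]
  · intro h; exact absurd (Finset.mem_univ i) h

/-- **(7.2.1) FOR THE PLAQUETTE DERIVATIVE OF THE LANDAU MINIMIZER ON THE TORI**: `(∂^{c}H_kB)(p) = Σ_{b∈T^{(k)}} K(p; b)B(b)` with the
kernel `K(p; b) = (∂^{c}H_ke_b)(p)` — *"The minimizer H_k can be expressed as an integral kernel … (7.2.1)"* (linearity of p11's `HkE`, of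
the carrier identification `toEj` and of the lattice curl). [cite: BalabanImbrieJaffe1985, (7.2.1) p.325] -/
theorem curlHk_apply_eq_sum (w c : ℝ) (k : ℕ) (B : PBond P k → ℝ) (p : TPlaq P 0) :
    curl c (WithLp.ofLp (HkE P w c k (toEj P k B))) p =
      ∑ b, curl c (WithLp.ofLp (HkE P w c k (toEj P k (Pi.single b 1)))) p * B b := by
  classical
  have hcurl : ∀ A : PBond P 0 → ℝ, curl c A p = curlLinK (P := P) 0 c A p := fun A => rfl
  conv_lhs => rw [pi_eq_sum_single' B]
  rw [map_sum, map_sum, WithLp.ofLp_sum, hcurl, map_sum, Finset.sum_apply]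
  refine Finset.sum_congr rfl fun b _ => ?_
  rw [map_smul, map_smul, WithLp.ofLp_smul, map_smul, Pi.smul_apply, smul_eq_mul, mul_comm, ← hcurl]

/-! ## §2  A kernel bound of the printed shape gives the sup-operator bound -/

/-- **The gradient member of (7.2.2) ⟹ «∂^{c}H_k is bounded ℓ^∞ → ℓ^∞»**: if `|K(p; b)| ≤ Me^{−δ·dist(p,b)}` (`0 ≤ M`) and the weights
have row sums `Σ_b e^{−δ·dist(p,b)} ≤ S`, then `|(∂^{c}H_kB)(p)| ≤ M·S·‖B‖_∞` — the hypothesis `hH` of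
`BIJ88Ineq217LandauTorus.abs_ineq217_landau_torus` with `M_H = M·S`. [cite: BalabanImbrieJaffe1985, (7.2.2) p.325] -/
theorem abs_curlHk_le_of_kernel (w c : ℝ) (k : ℕ) {dist : TPlaq P 0 → PBond P k → ℝ} {M δ S : ℝ} (hM : 0 ≤ M)
    (hK : ∀ (p : TPlaq P 0) (b : PBond P k),
      |curl c (WithLp.ofLp (HkE P w c k (toEj P k (Pi.single b 1)))) p| ≤ M * Real.exp (-δ * dist p b))
    (hS : ∀ p : TPlaq P 0, ∑ b, Real.exp (-δ * dist p b) ≤ S) (B : PBond P k → ℝ) (p : TPlaq P 0) :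
    |curl c (WithLp.ofLp (HkE P w c k (toEj P k B))) p| ≤ M * S * supNorm B := by
  rw [curlHk_apply_eq_sum]
  have hBn := supNorm_nonneg B
  calc |∑ b, curl c (WithLp.ofLp (HkE P w c k (toEj P k (Pi.single b 1)))) p * B b|
      ≤ ∑ b, |curl c (WithLp.ofLp (HkE P w c k (toEj P k (Pi.single b 1)))) p * B b| := Finset.abs_sum_le_sum_abs _ _
    _ ≤ ∑ b, M * Real.exp (-δ * dist p b) * supNorm B := Finset.sum_le_sum fun b _ => by
        rw [abs_mul]
        exact mul_le_mul (hK p b) (abs_le_supNorm B b) (abs_nonneg _) (by positivity)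
    _ = M * (∑ b, Real.exp (-δ * dist p b)) * supNorm B := by rw [Finset.mul_sum, Finset.sum_mul]
    _ ≤ M * S * supNorm B := mul_le_mul_of_nonneg_right (mul_le_mul_of_nonneg_left (hS p) hM) hBn

/-! ## §3  The printed distance `|x_k − y|` on the tori and its uniform row sums -/

/-- **Uniform exponential row sums over the unit bonds of `T^{(k)}`**: for the block distance `|x_k − b₋|` (`x_k = blk k x`, (I.5.1.2))
`Σ_{b∈T^{(k)}} e^{−δ|x_k(p) − b₋|} ≤ d·(2(1+δ⁻¹))^d` for every η-plaquette `p` and every `δ > 0`, uniformly in the volume and in `k`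
([B3] (2.15)-type torus sums, `B3TorusRadialSums.sum_exp_neg_tdist_le`; bonds = sites × directions, `bondEquiv`).
[cite: BalabanImbrieJaffe1985, (7.2.2) p.325] -/
theorem sum_bond_exp_neg_blkdist_le {k : ℕ} {δ : ℝ} (hδ : 0 < δ) (p : TPlaq P 0) :
    ∑ b : PBond P k, Real.exp (-δ * ((blk k p.src).tdist b.src : ℝ)) ≤ (P.d : ℝ) * (2 * (1 + δ⁻¹)) ^ P.d := by
  rw [← Fintype.sum_equiv (LatticeFieldCalculus.bondEquiv (P := P) (j := k))
    (fun q : TSite P k × Fin P.d => Real.exp (-δ * ((blk k p.src).tdist q.1 : ℝ))) _ (fun q => rfl),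
    Fintype.sum_prod_type]
  simp only [Finset.sum_const, Finset.card_univ, Fintype.card_fin, nsmul_eq_mul]
  rw [← Finset.mul_sum]
  refine mul_le_mul_of_nonneg_left ?_ (Nat.cast_nonneg _)
  refine le_trans (le_of_eq (Finset.sum_congr rfl fun y _ => by rw [neg_mul])) (sum_exp_neg_tdist_le hδ (blk k p.src))

/-- **The hypothesis `hH` of the Landau route from the printed kernel shape**: the gradient member of (7.2.2) for the torus `H_k`,
`|∂^{c}H_k(p; b)| ≤ Me^{−δ|x_k(p) − b₋|}` (`0 ≤ M`, `0 < δ`), gives `|(∂^{c}H_kB)(p)| ≤ M·d(2(1+δ⁻¹))^d·‖B‖_∞`.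
[cite: BalabanImbrieJaffe1985, (7.2.2) p.325] -/
theorem hH_of_gradKernel (w c : ℝ) (k : ℕ) {M δ : ℝ} (hM : 0 ≤ M) (hδ : 0 < δ)
    (hK : ∀ (p : TPlaq P 0) (b : PBond P k), |curl c (WithLp.ofLp (HkE P w c k (toEj P k (Pi.single b 1)))) p| ≤
      M * Real.exp (-δ * ((blk k p.src).tdist b.src : ℝ))) :
    ∀ (B : PBond P k → ℝ) (p : TPlaq P 0), |curl c (WithLp.ofLp (HkE P w c k (toEj P k B))) p| ≤
      M * ((P.d : ℝ) * (2 * (1 + δ⁻¹)) ^ P.d) * supNorm B :=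
  fun B p => abs_curlHk_le_of_kernel w c k hM hK (fun p => sum_bond_exp_neg_blkdist_le hδ p) B p

/-! ## §4  (2.17) on the torus from the two printed kernel estimates -/

/-- **(2.17) ON THE TORUS FOR THE σ_k OF RECORD FROM THE TWO KERNEL ESTIMATES PRINT CITES**: for p30's `σ_k = sigmaTorus hd w c k`, `f =
∂^{c/L^k}A` on the box of radius `R` about `p₁.src = castSite z₁` (`2R < sitesPerDir k`), (2.16) for the kernel of σ_k beyond `R` at `p₁`
(`h216`, row sum `S`), and the GRADIENT MEMBER OF [I] (7.2.2) for the torus `H_k` in kernel shape (`hK`: `|∂^{c}H_k(p; b)| ≤ Me^{−δ|x_k(p) −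
b₋|}`): `|(σ_kf)(p₁)| ≤ ((w·η^{−d})·M·d(2(1+δ⁻¹))^d·(d−1)·2R/|c/L^k| + c₀S(1 + 8(d−1)R))·‖f‖_∞` — `abs_ineq217_landau_torus` with `hH` supplied by
`hH_of_gradKernel`; `k ≤ m + K`, `w > 0`, `c ≠ 0`, `2 ≤ d`. [cite: BalabanImbrieJaffe1988, (2.17) p.262] -/
theorem abs_ineq217_gradKernel_torus (hd : 2 ≤ P.d) {k : ℕ} (hk : k ≤ P.m + P.K) {w : ℝ} (hw : 0 < w) {c : ℝ} (hc : c ≠ 0)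
    {M δH c₀ δ S : ℝ} (hM : 0 ≤ M) (hδH : 0 < δH) (hc₀ : 0 ≤ c₀)
    (hK : ∀ (p : TPlaq P 0) (b : PBond P k), |curl c (WithLp.ofLp (HkE P w c k (toEj P k (Pi.single b 1)))) p| ≤
      M * Real.exp (-δH * ((blk k p.src).tdist b.src : ℝ)))
    {R : ℕ} (hR : 2 * R < P.sitesPerDir k) {p₁ : TPlaq P k} {z₁ : Fin P.d → ℤ} (h₁ : p₁.src = castSite z₁)
    (h216 : ∀ p₂, (R : ℝ) ≤ pdist p₁ p₂ →
      |sigmaTorus (P := P) hd w c k (toU P k (Pi.single p₂ 1)) p₁| ≤ c₀ * Real.exp (-δ * pdist p₁ p₂))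
    (hS : ∑ p₂, Real.exp (-δ * pdist p₁ p₂) ≤ S)
    {f : TPlaq P k → ℝ} {A : VecField P k ℝ} (hf : ∀ p ∈ boxPlaqs (loOf z₁ R) (hiOf z₁ R), f p = curl (c / (P.L : ℝ) ^ k) A p) :
    |sigmaTorus (P := P) hd w c k (toU P k f) p₁| ≤
      (w * ((P.eta k)⁻¹) ^ P.d * (M * ((P.d : ℝ) * (2 * (1 + δH⁻¹)) ^ P.d)) * (((P.d - 1 : ℕ) : ℝ) * (2 * R : ℕ)) / |c / (P.L : ℝ) ^ k| +
        c₀ * S * (1 + 8 * ((P.d - 1 : ℕ) : ℝ) * R)) * supNorm f :=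
  abs_ineq217_landau_torus hd hk hw hc (by positivity) hc₀ (hH_of_gradKernel w c k hM hδH hK) hR h₁ h216 hS hf

/-- **… AT THE PRINTED NORMALISATION, k-INDEPENDENT CONSTANT**: `w = η^d`, `c = η⁻¹ = L^k`: `|(σ_kf)(p₁)| ≤ (M·d(2(1+δ⁻¹))^d·(d−1)·2R +
c₀S(1 + 8(d−1)R))·‖f‖_∞` — print's uniform (2.17) for the torus σ_k, modulo exactly the k-uniform kernel estimates (2.16) and [I] (7.2.2).
[cite: BalabanImbrieJaffe1988, (2.17) p.262] -/
theorem abs_ineq217_gradKernel_torus_eta (hd : 2 ≤ P.d) {k : ℕ} (hk : k ≤ P.m + P.K) {M δH c₀ δ S : ℝ} (hM : 0 ≤ M) (hδH : 0 < δH)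
    (hc₀ : 0 ≤ c₀)
    (hK : ∀ (p : TPlaq P 0) (b : PBond P k),
      |curl ((P.L : ℝ) ^ k) (WithLp.ofLp (HkE P ((P.eta k) ^ P.d) ((P.L : ℝ) ^ k) k (toEj P k (Pi.single b 1)))) p| ≤
        M * Real.exp (-δH * ((blk k p.src).tdist b.src : ℝ)))
    {R : ℕ} (hR : 2 * R < P.sitesPerDir k) {p₁ : TPlaq P k} {z₁ : Fin P.d → ℤ} (h₁ : p₁.src = castSite z₁)
    (h216 : ∀ p₂, (R : ℝ) ≤ pdist p₁ p₂ →
      |sigmaTorus (P := P) hd ((P.eta k) ^ P.d) ((P.L : ℝ) ^ k) k (toU P k (Pi.single p₂ 1)) p₁| ≤ c₀ * Real.exp (-δ * pdist p₁ p₂))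
    (hS : ∑ p₂, Real.exp (-δ * pdist p₁ p₂) ≤ S)
    {f : TPlaq P k → ℝ} {A : VecField P k ℝ} (hf : ∀ p ∈ boxPlaqs (loOf z₁ R) (hiOf z₁ R), f p = curl 1 A p) :
    |sigmaTorus (P := P) hd ((P.eta k) ^ P.d) ((P.L : ℝ) ^ k) k (toU P k f) p₁| ≤
      (M * ((P.d : ℝ) * (2 * (1 + δH⁻¹)) ^ P.d) * (((P.d - 1 : ℕ) : ℝ) * (2 * R : ℕ)) +
        c₀ * S * (1 + 8 * ((P.d - 1 : ℕ) : ℝ) * R)) * supNorm f :=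
  abs_ineq217_landau_torus_eta hd hk (by positivity) hc₀ (hH_of_gradKernel _ _ k hM hδH hK) hR h₁ h216 hS hf

end

end Literature.MathematicalPhysics.QuantumFieldTheory.BalabanImbrieJaffe1984to88.BIJ88Ineq217GradKernel
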